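import Summits.QuantumFields.YangMills.Theorems.BalabanLadderIRColdPurityDobrushinCorner
import Summits.QuantumFields.YangMills.Theorems.BalabanLadderIRPinnedExitRateForm
import HarnessLib

/-!
# Crux `BalabanLadder.IR` ∕ `IRcof` (stmt-QuantumFields-19354 ∕ 26930): the SIGN of the action-additivity defect
# `A_β(L,t) = ⟨S⟩_{β; L³×2t} − 2⟨S⟩_{β; L³×t}` ↔ MONOTONICITY of the cold purity defect `δᶜ_β(L)` in the coupling
# (helper; LEAD prover ym-ir-line-ab-p1 gen 8; def-free dictionary for the coordinator's IR reading «MONOTONE-ΔP», director-ym №47)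

HONEST STATUS.  Calculus over landed identities; nothing here proves the sign of `A` (no Griffiths ∕ GKS inequality for gauge theories
is in the tree or, to our knowledge, in print), PX(1/24), PXcof(1/24), `BalabanLadder.IR`, `IRcof`, or the Clay Yang–Mills mass gap (NOT
proved anywhere in this tree; R4 = the conditional finite-𝕋⁴ rung `BalabanLadder.UV` only).  Width 0 toward the stubs.

THE READING (coordinator ∕ director-ym №47, 2026-08-29): the instrument observable of `pub/ym-ir/FINITE-BOX-PURITY.md` is
`ΔP = log Z_β(L³×2t) − 2 log Z_β(L³×t) = log(1 − δᶜ_β(L))` (`t = ⌊L/4⌋`), whose `β`-derivative is `−A_β(L,t)` with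
`A_β(L,t) := ⟨S⟩_{β;L³×2t} − 2⟨S⟩_{β;L³×t}` the ACTION-ADDITIVITY DEFECT under time doubling (tree:
`ColdPurityDobrushin.hasDerivAt_negLogColdRatio`, `CouplingAxis.hasDerivAt_log_coldRatio`; `⟨·⟩ = finTorusExpectation`); guidance MC sees
`A` of one sign (no sign change) on `β_W ∈ [1.0, 2.1]` at `L = 8`; question (a) of №47: can the SIGN of `A` be PROVED?

THIS FILE types what a sign theorem would buy, BY NAME, so that every lens can cite the decls:
* `coldDefect_eq_one_sub_exp_neg` — `δᶜ_β(L) = 1 − exp(−F_β(L))`, `F_β(L) := −log(Z_β(L,L,L,2⌊L/4⌋)/Z_β(L,L,L,⌊L/4⌋)²)`.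
* `monotoneOn_coldDefect_of_actionDefect_nonneg` — **MONO⁺**: if `0 ≤ A_β(L,⌊L/4⌋)` on a convex set `D` of couplings then
  `β ↦ δᶜ_β(L)` is MONOTONE (non-decreasing) on `D`; `antitoneOn_coldDefect_of_actionDefect_nonpos` — **MONO⁻**: `A ≤ 0` on `D` ⇒ non-increasing.
  (Mean value theorem `monotoneOn_of_hasDerivWithinAt_nonneg` on the landed `HasDerivAt`.)
* `coldDefect_at_zero` — `δᶜ_0(L) = 0` (Haar probability: `Z_0 = 1`), so under MONO⁺ on `[0, β⋆]` the pure set `{β : δᶜ_β(L) ≤ θ}` is an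
  INITIAL SEGMENT: `coldDefect_le_of_le_of_actionDefect_nonneg` — a purity certificate `δᶜ_{β⋆}(L) ≤ θ` at ONE coupling transports to EVERY
  `β ∈ [β₀, β⋆]` («one crossing per box»; the 20–30× certification gap of the reading is then closed from above by ONE certified value).
* `rate_below_of_certified` — with the landed purity climb ∕ decay (`RateForm.rate_of_pinnedPureBox`): MONO⁺ on `[β, β⋆]` + ONE certified
  `1/24`-pure box `(β⋆, L)`, `L ≥ 8`, pinned by `s·L ≤ T`, gives the full exponential purity law `δᶜ_β(P) ≤ exp(−s·P/(2¹⁴T))` on `s·P ≥ 2¹⁵T`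
  at every smaller coupling `β ≥ 0`.
* READING for THE NUMBER (docstring of `coldDefect_le_of_le_of_actionDefect_nonneg`): MONO⁺ transports purity DOWN the coupling axis at a
  fixed lattice box, never up; PX(1/24) asks for a pure box of `≤ T` floor-lengths at EVERY large `β` — so MONO⁺ does not supply PX or PXcof
  (the physical sign: a fixed lattice box gets LESS pure as `β` grows), it makes the crossing coupling `β_θ(L) := sup{β : δᶜ_β(L) ≤ θ}` well
  defined and THE NUMBER equivalent to «`β_{1/24}(⌈T/a(β)⌉₊) ≥ β` for all large `β`» (designated-box face, `RateForm.pinnedExitAt24_iff_designated`).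

No new definition (MONO⁺ ∕ MONO⁻ are hypotheses spelled inline); nothing weakened or strengthened; floors not involved.

References: tree `BalabanLadderIRColdPurityDobrushinCorner` (pool-p3; `hasDerivAt_negLogColdRatio`, `wilsonFinTorusPartition_zero`),
`BalabanLadderIRCouplingDerivative` (idea-12 ∕ crit-3 invitation), `BalabanLadderIRPinnedExitRateForm` (LEAD g7); J. Engels, F. Karsch, H. Satz,
Nucl. Phys. B205 (1982) 239 (plaquette-difference method — background only, nothing cited as a fact).
-/

noncomputable section

open Set Filter Topology
open Literature.MathematicalPhysics.QuantumFieldTheory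
open Summit.QuantumFields.YangMills.Cruxes.IR.ColdPurityBridge (coldDefect)
open Summit.QuantumFields.YangMills.Cruxes.IR.ColdPurityDobrushin (hasDerivAt_negLogColdRatio wilsonFinTorusPartition_zero)
open Summit.QuantumFields.YangMills.Cruxes.IR.PinnedExit96.RateForm (rate_of_pinnedPureBox)

namespace Summit.QuantumFields.YangMills.Cruxes.IR.CouplingAxis.Sign

variable {G : Type} [Group G] [TopologicalSpace G] [IsTopologicalGroup G] [CompactSpace G]
  [MeasurableSpace G] [BorelSpace G]

/-! ## §1 `δᶜ = 1 − e^{−F}` -/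

/-- **`δᶜ_β(L) = 1 − exp(−F_β(L))`** with `F_β(L) = −log(Z_β(L,L,L,2⌊L/4⌋) ∕ Z_β(L,L,L,⌊L/4⌋)²)` (the ratio is positive). -/
theorem coldDefect_eq_one_sub_exp_neg (r : LatticeRep G) (β : ℝ) (L : ℕ) :
    coldDefect r.ρ β L =
      1 - Real.exp (-(-Real.log (wilsonFinTorusPartition r.ρ β L L L (2 * (L / 4)) /
        wilsonFinTorusPartition r.ρ β L L L (L / 4) ^ 2))) := by
  haveI : SecondCountableTopology G :=
    (r.continuous.isClosedEmbedding r.injective).isEmbedding.secondCountableTopology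
  have hpos : 0 < wilsonFinTorusPartition r.ρ β L L L (2 * (L / 4)) /
      wilsonFinTorusPartition r.ρ β L L L (L / 4) ^ 2 :=
    div_pos (wilsonFinTorusPartition_pos r.continuous β L L L _)
      (pow_pos (wilsonFinTorusPartition_pos r.continuous β L L L _) 2)
  rw [neg_neg, Real.exp_log hpos]
  rfl

/-! ## §2 Sign of the action-additivity defect ⇒ monotonicity of the cold defect in the coupling -/

/-- **MONO⁺ (PROVED implication): `A ≥ 0` on a convex set of couplings ⇒ `β ↦ δᶜ_β(L)` non-decreasing there.**  Hypothesis spelled with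
`finTorusExpectation` exactly as in `ColdPurityDobrushin.hasDerivAt_negLogColdRatio` (`t = ⌊L/4⌋`). -/
theorem monotoneOn_coldDefect_of_actionDefect_nonneg (r : LatticeRep G) (L : ℕ) {D : Set ℝ} (hD : Convex ℝ D)
    (hA : ∀ β ∈ D, 0 ≤
      finTorusExpectation r.ρ β (finTorusWilsonAction (n₀ := L) (n₁ := L) (n₂ := L) (n₃ := 2 * (L / 4)) r.ρ) -
        2 * finTorusExpectation r.ρ β (finTorusWilsonAction (n₀ := L) (n₁ := L) (n₂ := L) (n₃ := L / 4) r.ρ)) :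
    MonotoneOn (fun β : ℝ => coldDefect r.ρ β L) D := by
  set F : ℝ → ℝ := fun β => -Real.log (wilsonFinTorusPartition r.ρ β L L L (2 * (L / 4)) /
    wilsonFinTorusPartition r.ρ β L L L (L / 4) ^ 2) with hF
  have hderiv : ∀ β : ℝ, HasDerivAt F
      (finTorusExpectation r.ρ β (finTorusWilsonAction (n₀ := L) (n₁ := L) (n₂ := L) (n₃ := 2 * (L / 4)) r.ρ) -
        2 * finTorusExpectation r.ρ β (finTorusWilsonAction (n₀ := L) (n₁ := L) (n₂ := L) (n₃ := L / 4) r.ρ)) β :=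
    fun β => hasDerivAt_negLogColdRatio r L (L / 4) β
  have hFmono : MonotoneOn F D :=
    monotoneOn_of_hasDerivWithinAt_nonneg hD
      (fun β _ => (hderiv β).continuousAt.continuousWithinAt)
      (fun β _ => (hderiv β).hasDerivWithinAt)
      (fun β hβ => hA β (interior_subset hβ))
  intro β₁ h₁ β₂ h₂ h12
  show coldDefect r.ρ β₁ L ≤ coldDefect r.ρ β₂ L
  rw [coldDefect_eq_one_sub_exp_neg r β₁ L, coldDefect_eq_one_sub_exp_neg r β₂ L]
  have h := hFmono h₁ h₂ h12
  have hexp : Real.exp (-F β₂) ≤ Real.exp (-F β₁) := Real.exp_le_exp.2 (neg_le_neg h)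
  simp only [hF] at hexp
  linarith

/-- **MONO⁻ (PROVED implication): `A ≤ 0` on a convex set of couplings ⇒ `β ↦ δᶜ_β(L)` non-increasing there.** -/
theorem antitoneOn_coldDefect_of_actionDefect_nonpos (r : LatticeRep G) (L : ℕ) {D : Set ℝ} (hD : Convex ℝ D)
    (hA : ∀ β ∈ D,
      finTorusExpectation r.ρ β (finTorusWilsonAction (n₀ := L) (n₁ := L) (n₂ := L) (n₃ := 2 * (L / 4)) r.ρ) -
        2 * finTorusExpectation r.ρ β (finTorusWilsonAction (n₀ := L) (n₁ := L) (n₂ := L) (n₃ := L / 4) r.ρ) ≤ 0) :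
    AntitoneOn (fun β : ℝ => coldDefect r.ρ β L) D := by
  set F : ℝ → ℝ := fun β => -Real.log (wilsonFinTorusPartition r.ρ β L L L (2 * (L / 4)) /
    wilsonFinTorusPartition r.ρ β L L L (L / 4) ^ 2) with hF
  have hderiv : ∀ β : ℝ, HasDerivAt F
      (finTorusExpectation r.ρ β (finTorusWilsonAction (n₀ := L) (n₁ := L) (n₂ := L) (n₃ := 2 * (L / 4)) r.ρ) -
        2 * finTorusExpectation r.ρ β (finTorusWilsonAction (n₀ := L) (n₁ := L) (n₂ := L) (n₃ := L / 4) r.ρ)) β :=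
    fun β => hasDerivAt_negLogColdRatio r L (L / 4) β
  have hFanti : AntitoneOn F D :=
    antitoneOn_of_hasDerivWithinAt_nonpos hD
      (fun β _ => (hderiv β).continuousAt.continuousWithinAt)
      (fun β _ => (hderiv β).hasDerivWithinAt)
      (fun β hβ => hA β (interior_subset hβ))
  intro β₁ h₁ β₂ h₂ h12
  show coldDefect r.ρ β₂ L ≤ coldDefect r.ρ β₁ L
  rw [coldDefect_eq_one_sub_exp_neg r β₁ L, coldDefect_eq_one_sub_exp_neg r β₂ L]
  have h := hFanti h₁ h₂ h12
  have hexp : Real.exp (-F β₁) ≤ Real.exp (-F β₂) := Real.exp_le_exp.2 (neg_le_neg h)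
  simp only [hF] at hexp
  linarith

/-! ## §3 `β = 0` and the initial-segment structure of the pure set under MONO⁺ -/

/-- **`δᶜ_0(L) = 0`**: at `β = 0` the Wilson weight is `1` and both partition functions equal `1`. -/
theorem coldDefect_at_zero (r : LatticeRep G) (L : ℕ) : coldDefect r.ρ 0 L = 0 := by
  simp [coldDefect, wilsonFinTorusPartition_zero]

/-- **Downward transport of ONE purity certificate under MONO⁺ (PROVED).**  If `A_b(L,⌊L/4⌋) ≥ 0` for all `b ∈ [β, β⋆]` and the box `L` is
`θ`-pure at `β⋆`, then it is `θ`-pure at `β`.  READING: MONO⁺ moves purity DOWN the coupling axis at a fixed lattice box, never up —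
PX(1/24) (a pure box of `≤ T` floor-lengths at EVERY large `β`) is not supplied by MONO⁺; what MONO⁺ gives is «one crossing per box»:
with `coldDefect_at_zero`, the pure set `{β ≥ 0 : δᶜ_β(L) ≤ θ}` is an initial segment, so ONE certified value closes the window below it. -/
theorem coldDefect_le_of_le_of_actionDefect_nonneg (r : LatticeRep G) (L : ℕ) {β βs θ : ℝ} (hβ : β ≤ βs)
    (hA : ∀ b ∈ Icc β βs, 0 ≤
      finTorusExpectation r.ρ b (finTorusWilsonAction (n₀ := L) (n₁ := L) (n₂ := L) (n₃ := 2 * (L / 4)) r.ρ) -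
        2 * finTorusExpectation r.ρ b (finTorusWilsonAction (n₀ := L) (n₁ := L) (n₂ := L) (n₃ := L / 4) r.ρ))
    (hpure : coldDefect r.ρ βs L ≤ θ) : coldDefect r.ρ β L ≤ θ :=
  (monotoneOn_coldDefect_of_actionDefect_nonneg r L (convex_Icc β βs) hA
    (left_mem_Icc.2 hβ) (right_mem_Icc.2 hβ) hβ).trans hpure

/-- **The pure set is an initial segment under MONO⁺ on `[0, β⋆]` (PROVED)**: `δᶜ_{β⋆}(L) ≤ θ` ⇒ `δᶜ_β(L) ≤ θ` for every `β ∈ [0, β⋆]`. -/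
theorem pure_on_Icc_of_actionDefect_nonneg (r : LatticeRep G) (L : ℕ) {βs θ : ℝ}
    (hA : ∀ b ∈ Icc 0 βs, 0 ≤
      finTorusExpectation r.ρ b (finTorusWilsonAction (n₀ := L) (n₁ := L) (n₂ := L) (n₃ := 2 * (L / 4)) r.ρ) -
        2 * finTorusExpectation r.ρ b (finTorusWilsonAction (n₀ := L) (n₁ := L) (n₂ := L) (n₃ := L / 4) r.ρ))
    (hpure : coldDefect r.ρ βs L ≤ θ) : ∀ β ∈ Icc 0 βs, coldDefect r.ρ β L ≤ θ := fun _ hβ =>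
  coldDefect_le_of_le_of_actionDefect_nonneg r L hβ.2 (fun b hb => hA b ⟨hβ.1.trans hb.1, hb.2⟩) hpure

/-! ## §4 One certified pure box + MONO⁺ ⇒ the exponential purity law at every smaller coupling -/

/-- **Certified value + sign theorem ⇒ purity law below (PROVED).**  MONO⁺ on `[β, β⋆]` at side `L ≥ 8` (`β ≥ 0`), ONE certified `1/24`-pure box
`(β⋆, L)` pinned by `s·L ≤ T` (`s > 0` a length unit) ⇒ at the coupling `β`: `δᶜ_β(P) ≤ exp(−s·P ∕ (2¹⁴·T))` for every box with `s·P ≥ 2¹⁵·T`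
(downward transport, then the landed purity climb ∕ decay `RateForm.rate_of_pinnedPureBox`). -/
theorem rate_below_of_certified (r : LatticeRep G) {L : ℕ} (hL : 8 ≤ L) {β βs s T : ℝ} (hβ0 : 0 ≤ β) (hβ : β ≤ βs)
    (hs : 0 < s) (hpin : s * (L : ℝ) ≤ T)
    (hA : ∀ b ∈ Icc β βs, 0 ≤
      finTorusExpectation r.ρ b (finTorusWilsonAction (n₀ := L) (n₁ := L) (n₂ := L) (n₃ := 2 * (L / 4)) r.ρ) -
        2 * finTorusExpectation r.ρ b (finTorusWilsonAction (n₀ := L) (n₁ := L) (n₂ := L) (n₃ := L / 4) r.ρ))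
    (hcert : coldDefect r.ρ βs L ≤ 1 / 24) :
    ∀ P : ℕ, 32768 * T ≤ s * (P : ℝ) → coldDefect r.ρ β P ≤ Real.exp (-(s * (P : ℝ) / (16384 * T))) :=
  rate_of_pinnedPureBox r hβ0 hs hL hpin (coldDefect_le_of_le_of_actionDefect_nonneg r L hβ hA hcert)

end Summit.QuantumFields.YangMills.Cruxes.IR.CouplingAxis.Sign

end
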